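import Summits.Ventures.LatticeQCDFlow.Scoring.SU2TorusCharacterIntegral
import HarnessLib

/-!
# SU(2) on the 2-torus: the Haar integral of a product of plaquette characters WITH ONE PLAQUETTE TRACE INSERTED

HONEST FRAMING: exact (Metropolis-corrected) sampling algorithms for lattice gauge theory;
figures of merit are autocorrelation/cost numbers at stated couplings and volumes; no
continuum-physics claim.

Venture `LatticeQCDFlow` (cell pub-lqcd), sub-topic `Scoring`; FANOUT row 5 (`s0-sun-a`), GEN-10.
NEW WORK of the cell (placement rule); towards the EXACT finite-volume SU(2) plaquette on `(ℤ/L)²`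
(the value the row's oracle column tabulates at `16²`).  Inserting the half-trace `a₀(U_{x₀}) = ½ tr U_{x₀}`
of one plaquette into the product of characters shifts the representation at `x₀` by `±1`
(Chebyshev/Clebsch–Gordan: `a₀·χ_k = (χ_{k+1} + χ_{k−1})/2`, `χ_{−1} = 0`):

* `su2a0_mul_prod_su2Character` — pointwise,
  `a₀(U_{x₀})·∏_x χ_{m_x}(U_x) = ½ ∏_x χ_{m⁺_x}(U_x) + ½·[m_{x₀} ≠ 0]·∏_x χ_{m⁻_x}(U_x)`
  with `m^± = m` off `x₀` and `m^±_{x₀} = m_{x₀} ± 1`;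
* **`integral_su2a0_mul_prod_su2Character_plaquettes`** — hence, by
  `SU2TorusCharacterIntegral.integral_prod_su2Character_plaquettes`,
  `∫ a₀(U_{x₀}) ∏_x χ_{m_x}(U_x) dHaar^{⊗E} = ½·I(m⁺) + ½·[m_{x₀} ≠ 0]·I(m⁻)`,
  `I(m') = [m' constant]·((m'_0+1)^{L²})⁻¹`.

Elementary; nothing is cited; no `def`.
-/

noncomputable section

open Real MeasureTheory Set Function Finset Polynomial.Chebyshev
open Literature.MathematicalPhysics.QuantumFieldTheory Literature.MathematicalPhysics.QuantumLattice
open Summit.Ventures.LatticeQCDFlow.Exactness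

namespace Summit.Ventures.LatticeQCDFlow.Scoring

variable {L : ℕ} [NeZero L]

/-! ## §1. Inserting `a₀` shifts the representation at `x₀` by `±1` -/

/-- **Chebyshev / Clebsch–Gordan for `SU(2)`**: `t·U_k(t) = (U_{k+1}(t) + U_{k−1}(t))/2` (`k ∈ ℤ`,
`U_{−1} = 0`), i.e. `a₀·χ_k = (χ_{k+1} + χ_{k−1})/2`. -/
theorem mul_chebyshevU_eval (k : ℤ) (t : ℝ) :
    t * (U ℝ k).eval t = ((U ℝ (k + 1)).eval t + (U ℝ (k - 1)).eval t) / 2 := by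
  have h := congrArg (fun p : Polynomial ℝ => p.eval t) (U_add_one ℝ k)
  simp only [Polynomial.eval_sub, Polynomial.eval_mul, Polynomial.eval_ofNat, Polynomial.eval_X] at h
  linarith

/-- A product of plaquette characters with the representation at `x₀` updated splits off its
`x₀` factor. -/
theorem prod_su2Character_update {Ω : Type*} (t : Site 2 L → Ω → ℝ) (m : Site 2 L → ℕ)
    (x₀ : Site 2 L) (v : ℕ) (V : Ω) :
    ∏ x : Site 2 L, (U ℝ (update m x₀ v x)).eval (t x V) =
      (U ℝ v).eval (t x₀ V) * ∏ x ∈ Finset.univ.erase x₀, (U ℝ (m x)).eval (t x V) := by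
  rw [← Finset.mul_prod_erase _ _ (Finset.mem_univ x₀), update_self]
  congr 1
  refine Finset.prod_congr rfl fun x hx => ?_
  rw [update_of_ne (Finset.ne_of_mem_erase hx)]

/-- **Inserting one plaquette trace**, pointwise: with `m⁺ = update m x₀ (m_{x₀}+1)` and
`m⁻ = update m x₀ (m_{x₀}−1)`,
`a₀(U_{x₀})·∏_x χ_{m_x}(U_x) = ½·∏_x χ_{m⁺_x}(U_x) + ½·[m_{x₀} ≠ 0]·∏_x χ_{m⁻_x}(U_x)`. -/
theorem su2a0_mul_prod_su2Character {Ω : Type*} (t : Site 2 L → Ω → ℝ) (m : Site 2 L → ℕ)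
    (x₀ : Site 2 L) (V : Ω) :
    t x₀ V * ∏ x : Site 2 L, (U ℝ (m x)).eval (t x V) =
      (1 / 2) * ∏ x : Site 2 L, (U ℝ (update m x₀ (m x₀ + 1) x)).eval (t x V) +
        (1 / 2) * (if m x₀ = 0 then 0 else
          ∏ x : Site 2 L, (U ℝ (update m x₀ (m x₀ - 1) x)).eval (t x V)) := by
  rw [prod_su2Character_update, ← Finset.mul_prod_erase _ _ (Finset.mem_univ x₀), ← mul_assoc,
    mul_chebyshevU_eval]
  by_cases h0 : m x₀ = 0
  · rw [if_pos h0, h0]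
    push_cast
    simp only [U_neg_one, Polynomial.eval_zero, add_zero, mul_zero]
    ring
  · rw [if_neg h0, prod_su2Character_update]
    obtain ⟨j, hj⟩ := Nat.exists_eq_succ_of_ne_zero h0
    rw [hj, Nat.succ_sub_one]
    push_cast
    rw [add_sub_cancel_right]
    ring

/-! ## §2. The inserted character integral on the torus -/

/-- The product of plaquette characters is continuous in the configuration. -/
theorem continuous_prod_su2Character_plaquettes (m : Site 2 L → ℕ) :
    Continuous fun V : GaugeConfig 2 L (Matrix.specialUnitaryGroup (Fin 2) ℂ) =>
      ∏ x : Site 2 L, (U ℝ (m x)).eval (su2a0 (plaquetteHolonomy V x 0 1)) := by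
  refine continuous_finsetProd _ fun x _ => continuous_su2Character_comp (m x) ?_
  unfold plaquetteHolonomy
  fun_prop

/-- **THE INSERTED CHARACTER INTEGRAL ON THE 2-TORUS.**  For `L ≥ 1`, `m : Λ → ℕ`, a plaquette
`x₀` and product Haar measure on the links of `(ℤ/L)²`:
`∫ a₀(U_{x₀})·∏_x χ_{m_x}(U_x) dHaar^{⊗E} = ½·I(m⁺) + ½·[m_{x₀} ≠ 0]·I(m⁻)`, where
`I(m') = [∀ x, m'_x = m'_0]·((m'_0+1)^{L²})⁻¹` (`SU2TorusCharacterIntegral`) and `m^±` is `m` with the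
representation at `x₀` shifted by `±1`. -/
theorem integral_su2a0_mul_prod_su2Character_plaquettes (m : Site 2 L → ℕ) (x₀ : Site 2 L) :
    ∫ V, su2a0 (plaquetteHolonomy V x₀ 0 1) *
        ∏ x : Site 2 L, (U ℝ (m x)).eval (su2a0 (plaquetteHolonomy V x 0 1))
        ∂(Measure.pi fun _ : Edge 2 L => haarProbability (Matrix.specialUnitaryGroup (Fin 2) ℂ)) =
      (1 / 2) * (if (∀ x, update m x₀ (m x₀ + 1) x = update m x₀ (m x₀ + 1) 0) then
          ((((update m x₀ (m x₀ + 1) 0 : ℝ) + 1) ^ (L ^ 2)))⁻¹ else 0) +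
        (1 / 2) * (if m x₀ = 0 then 0 else
          if (∀ x, update m x₀ (m x₀ - 1) x = update m x₀ (m x₀ - 1) 0) then
            ((((update m x₀ (m x₀ - 1) 0 : ℝ) + 1) ^ (L ^ 2)))⁻¹ else 0) := by
  simp_rw [su2a0_mul_prod_su2Character (fun (x : Site 2 L)
    (V : GaugeConfig 2 L (Matrix.specialUnitaryGroup (Fin 2) ℂ)) => su2a0 (plaquetteHolonomy V x 0 1)) m x₀]
  have hi1 := integrable_pi_su2_of_continuous (ι := Edge 2 L)
    (continuous_prod_su2Character_plaquettes (update m x₀ (m x₀ + 1)))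
  rw [integral_add (hi1.const_mul _), integral_const_mul, integral_const_mul,
    integral_prod_su2Character_plaquettes (update m x₀ (m x₀ + 1))]
  · congr 1
    by_cases h0 : m x₀ = 0
    · simp_rw [if_pos h0]
      rw [integral_zero]
    · simp_rw [if_neg h0]
      rw [integral_prod_su2Character_plaquettes (update m x₀ (m x₀ - 1))]
  · by_cases h0 : m x₀ = 0
    · simp_rw [if_pos h0]
      exact (integrable_zero _ _ _).const_mul _
    · simp_rw [if_neg h0]
      exact (integrable_pi_su2_of_continuous (ι := Edge 2 L)
        (continuous_prod_su2Character_plaquettes (update m x₀ (m x₀ - 1)))).const_mul _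

end Summit.Ventures.LatticeQCDFlow.Scoring
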